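import Literature.Computability.Cryptography.WordRAMAchieves
import HarnessLib

/-!
# The word RAM — structured code: straight-line blocks, symbolic execution, loops with a potential

A toolkit on top of the structured layer `SProg`/`Exec` of
`Literature.Computability.Cryptography.WordRAMStructured` (Nipkow–Klein, *Concrete Semantics*,
Ch. 7, 8, 12), used by the verified reductions between APSP, the distance product and Negative
Triangle (Vassilevska Williams–Williams, J. ACM 65 (2018), Thm. 1.1):

* execution lemmas for the sequences `SProg.seqs` and straight-line blocks `SProg.block` of
  `Literature.Computability.Cryptography.WordRAMAchieves` (`Exec.seqs_cons`, `ExecLE.seqs_cons`,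
  `Exec.block'`, `Exec.block_of_fwd`);
* **symbolic execution one operation at a time**: `execOps_cons_fwd`, which names the value
  written by the next operation (a fresh `v` with its defining equation) instead of substituting
  it — the register file is kept as a tower of `Function.update`s over an opaque `S : ℕ → ℕ`
  below address `100` and the data as an opaque `H : ℕ → ℕ` above (`merge S H`), so that terms
  stay linear in the length of the block (each step is `obtain ⟨v, hv, hR⟩ := execOps_cons_fwd hR`
  followed by one `simp only [...] at hv hR` with the read/write lemmas of `merge` and the exact
  arithmetic of `BinOp.eval`, side conditions discharged by `omega`; see `copyBody_exec`);
* the **amortised loop rule** `SProg.ExecLE.whilenz_potential` (a `while` rule with a potential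
  `Φ` that pays for the time of every iteration; Nipkow–Klein §12.2 with a variant, here
  quantitative), for loops whose iteration count is data dependent;
* the verified **copy loop** `SProg.copyUp` (registers `12` = count, `13` = source, `14` =
  destination; `copyUp_exec`: `m` words in `6 m + 1` steps).

## References

* T. Nipkow, G. Klein, *Concrete Semantics with Isabelle/HOL*, Springer 2014, §7.2, §8.4, §12.2.
* T. Hagerup, *Sorting and searching on the word RAM*, STACS 1998, §2 (the machine).
* V. Vassilevska Williams, R. R. Williams, *Subcubic equivalences between path, matrix, and
  triangle problems*, J. ACM 65 (2018), Art. 27 (the programs this layer serves).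
-/

namespace Literature.Computability.Cryptography.WordRAM

open StateTransition

/-! ## Symbolic execution of straight-line code, one operation at a time -/

/-- One forward step of symbolic execution: from `execOps w m (s :: os) = R`, name the value `v`
written by `s`. [folklore] -/
theorem execOps_cons_fwd {w : ℕ} {m : ℕ → ℕ} {s : OpSpec} {os : List OpSpec} {R : ℕ → ℕ}
    (h : execOps w m (s :: os) = R) :
    ∃ v, s.1.eval w (s.2.2.1.read m) (s.2.2.2.read m) = v ∧ execOps w (s.2.1.write m v) os = R :=
  ⟨_, rfl, h⟩

namespace SProg

/-! ## Executing sequences and straight-line blocks (`SProg.seqs`, `SProg.block` of `WordRAMAchieves`) -/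

variable {w : ℕ} {O : List ℕ → List ℕ}

/-- Executing the empty sequence. [folklore] -/
theorem Exec.seqs_nil (st : Store) : Exec w O (seqs []) st st 0 := Exec.skip st

/-- Executing a nonempty sequence. [folklore] -/
theorem Exec.seqs_cons {s : SProg} {l : List SProg} {st st' st'' : Store} {t₁ t₂ : ℕ}
    (h₁ : Exec w O s st st' t₁) (h₂ : Exec w O (seqs l) st' st'' t₂) :
    Exec w O (seqs (s :: l)) st st'' (t₁ + t₂) := Exec.seq h₁ h₂

/-- Executing a one-element sequence. [folklore] -/
theorem Exec.seqs_one {s : SProg} {st st' : Store} {t : ℕ} (h : Exec w O s st st' t) :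
    Exec w O (seqs [s]) st st' t := by
  simpa using Exec.seqs_cons h (Exec.seqs_nil st')

/-- Bounded execution of a nonempty sequence. [folklore] -/
theorem ExecLE.seqs_cons {s : SProg} {l : List SProg} {st st' st'' : Store} {T₁ T₂ : ℕ}
    (h₁ : ExecLE w O s st st' T₁) (h₂ : ExecLE w O (seqs l) st' st'' T₂) :
    ExecLE w O (seqs (s :: l)) st st'' (T₁ + T₂) := ExecLE.seq h₁ h₂

/-- Bounded execution of a one-element sequence. [folklore] -/
theorem ExecLE.seqs_one {s : SProg} {st st' : Store} {T : ℕ} (h : ExecLE w O s st st' T) :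
    ExecLE w O (seqs [s]) st st' T := by
  obtain ⟨t, ht, h⟩ := h
  exact ⟨t, ht, Exec.seqs_one h⟩

/-- Transport of an execution along an equality of final stores. [folklore] -/
theorem Exec.of_eq {s : SProg} {st st₁ st₂ : Store} {t : ℕ} (h : Exec w O s st st₁ t)
    (he : st₁ = st₂) : Exec w O s st st₂ t := he ▸ h

/-- Straight-line execution (`Exec.block` of `WordRAMAchieves`) with the final memory supplied in
closed form. [folklore] -/
theorem Exec.block' (os : List OpSpec) {m m' : ℕ → ℕ} (qs : List (List ℕ))
    (h : execOps w m os = m') : Exec w O (SProg.block os) ⟨m, qs⟩ ⟨m', qs⟩ os.length := by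
  subst h; exact Exec.block os m qs

/-- **Block lemma template.** To execute a straight-line block from `⟨m, qs⟩` into a store
satisfying `P`, it suffices to run the symbolic execution forward from an arbitrary name `R` of
the final memory (`intro R hR`, one `execOps_cons_fwd` step per operation, `subst` at the end).
[folklore] -/
theorem Exec.block_of_fwd (os : List OpSpec) {m : ℕ → ℕ} (qs : List (List ℕ))
    {P : Store → Prop} (h : ∀ R, execOps w m os = R → P ⟨R, qs⟩) :
    ∃ st', Exec w O (SProg.block os) ⟨m, qs⟩ st' os.length ∧ P st' :=
  ⟨_, Exec.block' os qs rfl, h _ rfl⟩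

/-! ## The amortised loop rule -/

/-- **The `while` rule with a potential.** If from every store satisfying `Inv` on which the test
operand reads nonzero the body reaches a store satisfying `Inv` in time `t` with
`t + 2 + Φ(after) ≤ Φ(before)`, then from any `Inv`-store the loop `whilenz x s` terminates within
`Φ + 1` steps in an `Inv`-store on which the test operand reads `0` (Nipkow–Klein §12.2, the
variant made quantitative: the potential pays two steps of loop overhead plus the body per
iteration). [folklore] -/
theorem ExecLE.whilenz_potential {x : Operand} {s : SProg} (Inv : Store → Prop) (Φ : Store → ℕ)
    (hbody : ∀ st, Inv st → x.read st.mem ≠ 0 →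
      ∃ st' t, Exec w O s st st' t ∧ Inv st' ∧ t + 2 + Φ st' ≤ Φ st)
    {st : Store} (h0 : Inv st) :
    ∃ st', ExecLE w O (whilenz x s) st st' (Φ st + 1) ∧ Inv st' ∧ x.read st'.mem = 0 := by
  induction hN : Φ st using Nat.strong_induction_on generalizing st with
  | _ N ih =>
    by_cases hx : x.read st.mem = 0
    · exact ⟨st, ⟨1, by omega, Exec.while_zero hx⟩, h0, hx⟩
    · obtain ⟨st', t, hex, hinv', ht⟩ := hbody st h0 hx
      obtain ⟨st'', ⟨t'', ht'', hex''⟩, hinv'', hx''⟩ := ih (Φ st') (by omega) hinv' rfl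
      exact ⟨st'', ⟨t + t'' + 2, by omega, Exec.while_ne hx hex hex''⟩, hinv'', hx''⟩

/-- The amortised loop rule with an explicit initial budget `T ≥ Φ + 1`. [folklore] -/
theorem ExecLE.whilenz_potential' {x : Operand} {s : SProg} (Inv : Store → Prop) (Φ : Store → ℕ)
    (hbody : ∀ st, Inv st → x.read st.mem ≠ 0 →
      ∃ st' t, Exec w O s st st' t ∧ Inv st' ∧ t + 2 + Φ st' ≤ Φ st)
    {st : Store} (h0 : Inv st) {T : ℕ} (hT : Φ st + 1 ≤ T) :
    ∃ st', ExecLE w O (whilenz x s) st st' T ∧ Inv st' ∧ x.read st'.mem = 0 := by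
  obtain ⟨st', h, h'⟩ := ExecLE.whilenz_potential Inv Φ hbody h0
  exact ⟨st', h.mono hT, h'⟩

/-! ## The copy loop

`copyUp`: while `r12 ≠ 0`: `mem[r14] := mem[r13]; r13 += 1; r14 += 1; r12 -= 1` — copies the
`m` data words at `s = r13` to `d = r14`, lowest address first. (This is the structured-layer
counterpart, over `merge` with registers `12, 13, 14`, of the flat copy loop `cuBody` of
`Literature.Computability.Cryptography.WordRAMInline1`, registers `19, 33, 20` over base `40`.) -/

/-- The body of the copy loop. [folklore] -/
def copyBody : List OpSpec :=
  [(.add, .ind 14, .ind 13, .imm 0), (.add, .dir 13, .dir 13, .imm 1),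
    (.add, .dir 14, .dir 14, .imm 1), (.sub, .dir 12, .dir 12, .imm 1)]

/-- The copy loop (registers `12` = count, `13` = source pointer, `14` = destination pointer). [folklore] -/
def copyUp : SProg :=
  whilenz (.dir 12) (block copyBody)

/-- `copyUp` makes no oracle query. [folklore] -/
theorem copyUp_queryFree : copyUp.QueryFree := block_queryFree _

/-- Registers after `j` iterations of the copy loop. [folklore] -/
def cuR (R : ℕ → ℕ) (m s d j : ℕ) : ℕ → ℕ :=
  Function.update (Function.update (Function.update R 12 (m - j)) 13 (s + j)) 14 (d + j)

/-- Data after `j` iterations of the copy loop: `[d, d + j)` holds a copy of `[s, s + j)`. [folklore] -/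
def cuH (H : ℕ → ℕ) (s d j : ℕ) : ℕ → ℕ := fun a =>
  if d ≤ a ∧ a < d + j then H (s + (a - d)) else H a

/-- Register `12` during the copy loop. [folklore] -/
theorem cuR_12 (R : ℕ → ℕ) (m s d j : ℕ) : cuR R m s d j 12 = m - j := by
  simp [cuR]

/-- Register `13` during the copy loop. [folklore] -/
theorem cuR_13 (R : ℕ → ℕ) (m s d j : ℕ) : cuR R m s d j 13 = s + j := by
  simp [cuR]

/-- Register `14` during the copy loop. [folklore] -/
theorem cuR_14 (R : ℕ → ℕ) (m s d j : ℕ) : cuR R m s d j 14 = d + j := by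
  simp [cuR]

/-- The other registers are untouched by the copy loop. [folklore] -/
theorem cuR_of_ne (R : ℕ → ℕ) (m s d j : ℕ) {a : ℕ} (h12 : a ≠ 12) (h13 : a ≠ 13) (h14 : a ≠ 14) :
    cuR R m s d j a = R a := by
  simp [cuR, h12, h13, h14]

/-- The data after the copy loop, read inside the destination. [folklore] -/
theorem cuH_apply_dst (H : ℕ → ℕ) (s d m : ℕ) {i : ℕ} (hi : i < m) :
    cuH H s d m (d + i) = H (s + i) := by
  simp only [cuH]
  rw [if_pos (by omega)]
  congr 1; omega

/-- The data after the copy loop, read outside the destination. [folklore] -/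
theorem cuH_apply_of_not (H : ℕ → ℕ) (s d m : ℕ) {a : ℕ} (ha : a < d ∨ d + m ≤ a) :
    cuH H s d m a = H a := by
  simp only [cuH]
  rw [if_neg (by omega)]

/-- No iterations: no change. [folklore] -/
theorem cuH_zero (H : ℕ → ℕ) (s d : ℕ) : cuH H s d 0 = H := by
  funext a; simp [cuH]

section copy

set_option linter.unusedSimpArgs false in
/-- One iteration of the copy loop. [folklore] -/
theorem copyBody_exec {R H : ℕ → ℕ} {m s d j : ℕ} (hj : j < m) (hs : 100 ≤ s) (hd : 100 ≤ d)
    (hdisj : s + m ≤ d ∨ d ≤ s) (hval : ∀ i, i < m → H (s + i) < 2 ^ w)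
    (hsw : s + m < 2 ^ w) (hdw : d + m < 2 ^ w) (qs : List (List ℕ)) :
    Exec w O (block copyBody) ⟨merge (cuR R m s d j) (cuH H s d j), qs⟩
      ⟨merge (cuR R m s d (j + 1)) (cuH H s d (j + 1)), qs⟩ 4 := by
  have h12 : cuR R m s d j 12 = m - j := cuR_12 R m s d j
  have h13 : cuR R m s d j 13 = s + j := cuR_13 R m s d j
  have h14 : cuR R m s d j 14 = d + j := cuR_14 R m s d j
  have hsrc : cuH H s d j (s + j) = H (s + j) := by
    simp only [cuH]; rw [if_neg (by omega)]
  have hvj := hval j hj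
  have key : ∀ Rf, execOps w (merge (cuR R m s d j) (cuH H s d j)) copyBody = Rf →
      Rf = merge (cuR R m s d (j + 1)) (cuH H s d (j + 1)) := by
    intro Rf hR
    unfold copyBody at hR
    have htmp := execOps_cons_fwd hR; clear hR; obtain ⟨v1, hv1, hR⟩ := htmp
    simp -failIfUnchanged (disch := omega) only [Operand.write, Operand.read, merge_apply_of_lt,
      merge_apply_of_le, Function.update_self, Function.update_of_ne, update_merge_of_lt,
      update_merge_of_le, Nat.add_zero, BinOp.eval_mod, BinOp.eval_eq, BinOp.eval_band,
      BinOp.eval_shr, BinOp.eval_div, BinOp.eval_lt, BinOp.eval_add_of_lt, BinOp.eval_sub_of_le,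
      BinOp.eval_mul_of_lt, h12, h13, h14, hsrc] at hv1 hR
    have htmp := execOps_cons_fwd hR; clear hR; obtain ⟨v2, hv2, hR⟩ := htmp
    simp -failIfUnchanged (disch := omega) only [Operand.write, Operand.read, merge_apply_of_lt,
      merge_apply_of_le, Function.update_self, Function.update_of_ne, update_merge_of_lt,
      update_merge_of_le, Nat.add_zero, BinOp.eval_mod, BinOp.eval_eq, BinOp.eval_band,
      BinOp.eval_shr, BinOp.eval_div, BinOp.eval_lt, BinOp.eval_add_of_lt, BinOp.eval_sub_of_le,
      BinOp.eval_mul_of_lt, h12, h13, h14] at hv2 hR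
    have htmp := execOps_cons_fwd hR; clear hR; obtain ⟨v3, hv3, hR⟩ := htmp
    simp -failIfUnchanged (disch := omega) only [Operand.write, Operand.read, merge_apply_of_lt,
      merge_apply_of_le, Function.update_self, Function.update_of_ne, update_merge_of_lt,
      update_merge_of_le, Nat.add_zero, BinOp.eval_mod, BinOp.eval_eq, BinOp.eval_band,
      BinOp.eval_shr, BinOp.eval_div, BinOp.eval_lt, BinOp.eval_add_of_lt, BinOp.eval_sub_of_le,
      BinOp.eval_mul_of_lt, h12, h13, h14] at hv3 hR
    have htmp := execOps_cons_fwd hR; clear hR; obtain ⟨v4, hv4, hR⟩ := htmp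
    simp -failIfUnchanged (disch := omega) only [Operand.write, Operand.read, merge_apply_of_lt,
      merge_apply_of_le, Function.update_self, Function.update_of_ne, update_merge_of_lt,
      update_merge_of_le, Nat.add_zero, BinOp.eval_mod, BinOp.eval_eq, BinOp.eval_band,
      BinOp.eval_shr, BinOp.eval_div, BinOp.eval_lt, BinOp.eval_add_of_lt, BinOp.eval_sub_of_le,
      BinOp.eval_mul_of_lt, h12, h13, h14] at hv4 hR
    simp only [execOps_nil] at hR; subst hR
    subst hv1 hv2 hv3 hv4
    congr 1
    · funext a
      simp only [cuR, Function.update_apply]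
      split_ifs <;> omega
    · funext a
      simp only [cuH, Function.update_apply]
      split_ifs <;> first | rfl | omega | (subst_vars; congr 1; omega)
  exact Exec.block' copyBody qs (key _ rfl)

/-- **Semantics of the copy loop.** With count `m` in register `12`, source `s` in `13`,
destination `d` in `14` (data addresses; the destination either starts after the source segment
or at or below the source, so that an ascending copy never overwrites a word it has yet to read;
no wrap-around), `copyUp` copies the `m` words `[s, s + m)` to `[d, d + m)` in `6 m + 1` steps;
afterwards register `12` is `0` and the pointers are advanced by `m`. [folklore] -/
theorem copyUp_exec {R H : ℕ → ℕ} {m s d : ℕ} (h12 : R 12 = m) (h13 : R 13 = s) (h14 : R 14 = d)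
    (hs : 100 ≤ s) (hd : 100 ≤ d) (hdisj : s + m ≤ d ∨ d ≤ s)
    (hval : ∀ i, i < m → H (s + i) < 2 ^ w) (hsw : s + m < 2 ^ w) (hdw : d + m < 2 ^ w)
    (qs : List (List ℕ)) :
    Exec w O copyUp ⟨merge R H, qs⟩ ⟨merge (cuR R m s d m) (cuH H s d m), qs⟩ (6 * m + 1) := by
  have hR0 : R = cuR R m s d 0 := by
    funext a
    simp only [cuR, Function.update_apply]
    split_ifs with h1 h2 h3
    · subst h1; simpa using h14
    · subst h2; simpa using h13
    · subst h3; simpa using h12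
    · rfl
  have hH0 : H = cuH H s d 0 := (cuH_zero H s d).symm
  have hloop := Exec.whilenz_iter (w := w) (O := O) (x := .dir 12) (s := block copyBody) m
    (fun j => ⟨merge (cuR R m s d j) (cuH H s d j), qs⟩) (fun _ => 4)
    (fun j hj => by
      show (Operand.dir 12).read (merge (cuR R m s d j) (cuH H s d j)) ≠ 0
      rw [Operand.read_dir_merge (by decide), cuR_12]; omega)
    (by
      show (Operand.dir 12).read (merge (cuR R m s d m) (cuH H s d m)) = 0
      rw [Operand.read_dir_merge (by decide), cuR_12]; omega)
    (fun j hj => copyBody_exec hj hs hd hdisj hval hsw hdw qs)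
  have hst : (⟨merge R H, qs⟩ : Store) = ⟨merge (cuR R m s d 0) (cuH H s d 0), qs⟩ := by
    rw [← hR0, ← hH0]
  have ht : 6 * m + 1 = 1 + ∑ i ∈ Finset.range m, (4 + 2) := by
    rw [Finset.sum_const, Finset.card_range, smul_eq_mul]; omega
  rw [hst, ht]
  exact hloop

/-- The copy loop in specification form: the registers other than `12, 13, 14` are kept, the
destination holds the copy, the rest of the data is kept. [folklore] -/
theorem copyUp_spec {R H : ℕ → ℕ} {m s d : ℕ} (h12 : R 12 = m) (h13 : R 13 = s) (h14 : R 14 = d)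
    (hs : 100 ≤ s) (hd : 100 ≤ d) (hdisj : s + m ≤ d ∨ d ≤ s)
    (hval : ∀ i, i < m → H (s + i) < 2 ^ w) (hsw : s + m < 2 ^ w) (hdw : d + m < 2 ^ w)
    (qs : List (List ℕ)) :
    ∃ R' H', Exec w O copyUp ⟨merge R H, qs⟩ ⟨merge R' H', qs⟩ (6 * m + 1) ∧
      (∀ a, a ≠ 12 → a ≠ 13 → a ≠ 14 → R' a = R a) ∧ R' 14 = d + m ∧
      (∀ i, i < m → H' (d + i) = H (s + i)) ∧ (∀ a, a < d ∨ d + m ≤ a → H' a = H a) :=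
  ⟨_, _, copyUp_exec h12 h13 h14 hs hd hdisj hval hsw hdw qs,
    fun _ ha hb hc => cuR_of_ne R m s d m ha hb hc, cuR_14 R m s d m,
    fun _ hi => cuH_apply_dst H s d m hi, fun _ ha => cuH_apply_of_not H s d m ha⟩

end copy

end SProg

end Literature.Computability.Cryptography.WordRAM
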